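import Mathlib

/-!
# Odd conservation laws of the pinned anharmonic chain — the polynomial algebra (definitions)

Definitions file for the NEGATIVE edge of crux `HiddenChargeMazur.OddChargeExists`
(item stmt-AtomisticToContinuum-13511): the classification "every momentum-odd polynomial local
conservation law of `pinnedChain ω₂ lam β γ` (`lam ≠ 0`, `β ≠ 0`) is a shift-coboundary", proved in the
files `HiddenChargeMazurOddChargeAlgebra*.lean` and composed with
`OddChargeExists.Negative.oddChargeExists_needs_nonCoboundaryLaw` into `¬ OddChargeExists`.

Everything here is an explicit, elementary object of the infinite-chain polynomial algebra
`𝓡 = ℝ[q_x, p_x : x ∈ ℤ]` (`MvPolynomial (ℤ ⊕ ℤ) ℝ`, `Sum.inl x ↦ q_x`, `Sum.inr x ↦ p_x`):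

* gradings: `Var.site`, the weight `wt` (`q ↦ 1`, `p ↦ 2`), the momentum weight `pwt` (`q ↦ 0`, `p ↦ 1`);
* algebra maps: the site translation `shiftBy k` / `shift` (`q_x ↦ q_{x+k}`), momentum reversal `rev`
  (`p ↦ -p`), the substitutions `killVar v` (`X v ↦ 0`), `killP` (all momenta `↦ 0`), `fuse k`
  (`q_k ↦ q_{k+1}`) and the shear `shear k s` (`q_k ↦ q_k + s•q_{k+1}`);
* derivations: free streaming `Aplus = Σ p_x ∂_{q_x}`, the Liouville operator `liouville ω₂ lam β` of
  `pinnedChain` (`q_x ↦ p_x`, `p_x ↦ -U'(q_x) + V'(q_{x+1}-q_x) - V'(q_x-q_{x-1})`) and its top-weight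
  (quartic) part `lplus lam β`;
* the boundary operator `bup D` of the leading-order analysis, the cubic `cub a b = a³-3a²b+3ab²`
  (`= (a-b)³+b³`), the bond differences `gam j = q_j - q_{j+1}` and `prodsq s = ∏_{j∈s} gam j ²`;
* the closed forms `lead0 leadD lead1 leadMid leadLast` of the forced leading coefficients and the
  clash polynomial `clashQuad` of the all-span recursion (lead prover, crux workfile MATH.md);
* monomial bookkeeping for the left-aligned normal form: `msites`, `minsite`, `maxsite`, `nfMon`,
  the normal form `nf` (each monomial translated to minimal site `0`, via the monomial lift `liftMon`) and
  the projections `proj`, `projSD`.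

No mathematics here beyond the splitting `liouville = lplus + lminus`; every object is a finite explicit formula. [folklore]
-/

noncomputable section

open MvPolynomial Finsupp
open scoped BigOperators

namespace Summit.AtomisticToContinuum.FouriersLaw.Theorems.OddChargeAlgebra

/-- The variables of the infinite chain: `Sum.inl x` is the position `q_x`, `Sum.inr x` the momentum
`p_x` of site `x ∈ ℤ`. [folklore] -/
abbrev Var : Type := ℤ ⊕ ℤ

/-- The chain algebra `𝓡 = ℝ[q_x, p_x : x ∈ ℤ]`. [folklore] -/
abbrev R : Type := MvPolynomial Var ℝ

/-- The site of a variable (`q_x ↦ x`, `p_x ↦ x`). [folklore] -/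
def Var.site : Var → ℤ := Sum.elim id id

/-- The scaling weight of the quartic chain: `q ↦ 1`, `p ↦ 2` (the quartic Liouville operator raises it
by exactly one, the harmonic part lowers it by one). [folklore] -/
def wt : Var → ℕ := Sum.elim (fun _ => 1) (fun _ => 2)

/-- The momentum weight: `q ↦ 0`, `p ↦ 1`; `Finsupp.weight pwt m` is the momentum degree of a monomial. [folklore] -/
def pwt : Var → ℕ := Sum.elim (fun _ => 0) (fun _ => 1)

/-- Translation of the variables by `k` sites. [folklore] -/
def transl (k : ℤ) : Var → Var := Sum.map (· + k) (· + k)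

/-- The site translation `q_x ↦ q_{x+k}`, `p_x ↦ p_{x+k}` of the chain algebra. [folklore] -/
def shiftBy (k : ℤ) : R →ₐ[ℝ] R := rename (transl k)

/-- The shift `S` (`q_x ↦ q_{x+1}`, `p_x ↦ p_{x+1}`); a local conservation law is `L g ∈ (1 - S)𝓡`. [folklore] -/
def shift : R →ₐ[ℝ] R := shiftBy 1

/-- Momentum reversal `Θ` (`q_x ↦ q_x`, `p_x ↦ -p_x`); a density `g` is momentum-odd iff `rev g = -g`. [folklore] -/
def rev : R →ₐ[ℝ] R := aeval (Sum.elim (fun x => X (Sum.inl x)) (fun x => -X (Sum.inr x)))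

/-- The substitution `X v ↦ 0` (restriction to the hyperplane `X v = 0`). [folklore] -/
def killVar (v : Var) : R →ₐ[ℝ] R := aeval (fun w => if w = v then 0 else X w)

/-- The substitution of `0` for every momentum (restriction to `p = 0`). [folklore] -/
def killP : R →ₐ[ℝ] R := aeval (Sum.elim (fun x => X (Sum.inl x)) (fun _ => 0))

/-- The substitution `q_k ↦ q_{k+1}` (restriction to the diagonal `q_k = q_{k+1}`, i.e. `gam k = 0`). [folklore] -/
def fuse (k : ℤ) : R →ₐ[ℝ] R := aeval (fun w => if w = Sum.inl k then X (Sum.inl (k + 1)) else X w)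

/-- The shear automorphism `q_k ↦ q_k + s • q_{k+1}` (`s = 1` and `s = -1` are mutually inverse;
`killVar (q_k) ∘ shear k 1 = fuse k`). [folklore] -/
def shear (k : ℤ) (s : ℝ) : R →ₐ[ℝ] R :=
  aeval (fun w => if w = Sum.inl k then X (Sum.inl k) + C s * X (Sum.inl (k + 1)) else X w)

/-- Free streaming `A⁺ = Σ_x p_x ∂_{q_x}` (the kinetic part of every Liouville operator), as a derivation. [folklore] -/
def Aplus : Derivation ℝ R R :=
  mkDerivation ℝ (Sum.elim (fun x => (X (Sum.inr x) : R)) (fun _ => 0))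

/-- The cubic `cub a b = a³ - 3a²b + 3ab² = (a - b)³ + b³`: the part of `(a - b)³` that involves `a`. [folklore] -/
def cub (a b : R) : R := a ^ 3 - 3 * a ^ 2 * b + 3 * a * b ^ 2

/-- The force of `pinnedChain ω₂ lam β γ` on site `x`:
`-U'(q_x) + V'(q_{x+1} - q_x) - V'(q_x - q_{x-1})` with `U' t = ω₂ t + lam t³`, `V' r = r + β r³`. [folklore] -/
def force (ω₂ lam β : ℝ) (x : ℤ) : R :=
  -(C ω₂ * X (Sum.inl x) + C lam * X (Sum.inl x) ^ 3)
    + ((X (Sum.inl (x + 1)) - X (Sum.inl x)) + C β * (X (Sum.inl (x + 1)) - X (Sum.inl x)) ^ 3)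
    - ((X (Sum.inl x) - X (Sum.inl (x - 1))) + C β * (X (Sum.inl x) - X (Sum.inl (x - 1))) ^ 3)

/-- The top-weight (cubic) part of `force`: `-lam q_x³ + β((q_{x+1}-q_x)³ - (q_x-q_{x-1})³)`. [folklore] -/
def forcePlus (lam β : ℝ) (x : ℤ) : R :=
  -(C lam * X (Sum.inl x) ^ 3)
    + C β * ((X (Sum.inl (x + 1)) - X (Sum.inl x)) ^ 3 - (X (Sum.inl x) - X (Sum.inl (x - 1))) ^ 3)

/-- The harmonic (weight-lowering) part of `force`: `-ω₂ q_x + (q_{x+1} - 2 q_x + q_{x-1})`. [folklore] -/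
def forceMinus (ω₂ : ℝ) (x : ℤ) : R :=
  -(C ω₂ * X (Sum.inl x)) + (X (Sum.inl (x + 1)) - X (Sum.inl x)) - (X (Sum.inl x) - X (Sum.inl (x - 1)))

/-- The Liouville operator of the infinite chain `pinnedChain ω₂ lam β γ` as a derivation of `𝓡`:
`q_x ↦ p_x`, `p_x ↦ force ω₂ lam β x`. [folklore] -/
def liouville (ω₂ lam β : ℝ) : Derivation ℝ R R :=
  mkDerivation ℝ (Sum.elim (fun x => (X (Sum.inr x) : R)) (fun x => force ω₂ lam β x))

/-- The top-weight part `L₊` of `liouville` (the Liouville operator of the homogeneous quartic chain):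
`q_x ↦ p_x`, `p_x ↦ forcePlus lam β x`; it raises `wt` by one. [folklore] -/
def lplus (lam β : ℝ) : Derivation ℝ R R :=
  mkDerivation ℝ (Sum.elim (fun x => (X (Sum.inr x) : R)) (fun x => forcePlus lam β x))

/-- The weight-lowering part `L₋` of `liouville`: `q_x ↦ 0`, `p_x ↦ forceMinus ω₂ x`. [folklore] -/
def lminus (ω₂ : ℝ) : Derivation ℝ R R :=
  mkDerivation ℝ (Sum.elim (fun _ => (0 : R)) (fun x => forceMinus ω₂ x))

/-- The boundary operator `B↑_D` of the leading-order analysis on densities of span `D`: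
`B↑_D h = cub(q_{D+1}, q_D) ∂_{p_D} h + cub(q_0, q_1) S(∂_{p_0} h)` — the span-raising part of the
quartic interaction force acting on `h`, left-aligned. [folklore] -/
def bup (D : ℤ) (h : R) : R :=
  cub (X (Sum.inl (D + 1))) (X (Sum.inl D)) * pderiv (Sum.inr D) h
    + cub (X (Sum.inl 0)) (X (Sum.inl 1)) * shift (pderiv (Sum.inr 0) h)

/-- The bond difference `γ_j = q_j - q_{j+1}`. [folklore] -/
def gam (j : ℤ) : R := X (Sum.inl j) - X (Sum.inl (j + 1))

/-- `prodsq s = ∏_{j ∈ s} γ_j²`. [folklore] -/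
def prodsq (s : Finset ℤ) : R := ∏ j ∈ s, gam j ^ 2

/-- Forced form of the left end coefficient `a_0 = cub(q_D,q_{D-1}) ∏_{j=0}^{D-2} γ_j²` of a leading
p-linear member (normalised, `c = 1`). [folklore] -/
def lead0 (D : ℤ) : R := cub (X (Sum.inl D)) (X (Sum.inl (D - 1))) * prodsq (Finset.Ico 0 (D - 1))

/-- Forced form of the right end coefficient `a_D = -cub(q_0,q_1) ∏_{j=1}^{D-1} γ_j²`. [folklore] -/
def leadD (D : ℤ) : R := -(cub (X (Sum.inl 0)) (X (Sum.inl 1)) * prodsq (Finset.Ico 1 D))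

/-- Forced form of `a_1` (`D ≥ 3`):
`⅓ cub(q_D,q_{D-1}) γ_1 (6 cub(q_0,q_1) + (-3q_0² + 6q_0q_1) γ_1) ∏_{j=2}^{D-2} γ_j²`. [folklore] -/
def lead1 (D : ℤ) : R :=
  C (1 / 3 : ℝ) * (cub (X (Sum.inl D)) (X (Sum.inl (D - 1))) * gam 1
    * (6 * cub (X (Sum.inl 0)) (X (Sum.inl 1))
        + (-(3 * X (Sum.inl 0) ^ 2) + 6 * X (Sum.inl 0) * X (Sum.inl 1)) * gam 1)
    * prodsq (Finset.Ico 2 (D - 1)))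

/-- Forced form of the interior coefficients `a_y`, `2 ≤ y ≤ D-2`:
`⅓ cub(q_0,q_1) cub(q_D,q_{D-1}) γ_{y-1} γ_y ((4y+2)γ_{y-1} - (4y-2)γ_y) ∏_{1≤j≤D-2, j∉{y-1,y}} γ_j²`. [folklore] -/
def leadMid (D y : ℤ) : R :=
  C (1 / 3 : ℝ) * (cub (X (Sum.inl 0)) (X (Sum.inl 1)) * cub (X (Sum.inl D)) (X (Sum.inl (D - 1)))
    * gam (y - 1) * gam y * (C ((4 * y + 2 : ℤ) : ℝ) * gam (y - 1) - C ((4 * y - 2 : ℤ) : ℝ) * gam y)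
    * (prodsq (Finset.Ico 1 (y - 1)) * prodsq (Finset.Ico (y + 1) (D - 1))))

/-- Forced form of `a_{D-1}` (`D ≥ 4`): with `u,v,w = q_{D-2}, q_{D-1}, q_D`,
`cub(q_0,q_1) γ_{D-2} ∏_{j=1}^{D-3} γ_j² · w · ((4D-2)uv - (2D-1)uw - (8D-8)v² + (6D-7)vw - (4D-6)/3 w²)`. [folklore] -/
def leadLast (D : ℤ) : R :=
  cub (X (Sum.inl 0)) (X (Sum.inl 1)) * gam (D - 2) * prodsq (Finset.Ico 1 (D - 2)) * X (Sum.inl D)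
    * (C ((4 * D - 2 : ℤ) : ℝ) * X (Sum.inl (D - 2)) * X (Sum.inl (D - 1))
        - C ((2 * D - 1 : ℤ) : ℝ) * X (Sum.inl (D - 2)) * X (Sum.inl D)
        - C ((8 * D - 8 : ℤ) : ℝ) * X (Sum.inl (D - 1)) ^ 2
        + C ((6 * D - 7 : ℤ) : ℝ) * X (Sum.inl (D - 1)) * X (Sum.inl D)
        - C (((4 * D - 6 : ℤ) : ℝ) / 3) * X (Sum.inl D) ^ 2)

/-- The clash polynomial: with `v,w,z = q_{D-1}, q_D, q_{D+1}`, `6vw - 3vz - 12w² + 9wz - 2z²`; the forced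
leading family violates the last transport equation by `2D·c·cub(q_0,q_1) γ_{D-1} ∏_{j=1}^{D-2}γ_j² · z · clashQuad D`. [folklore] -/
def clashQuad (D : ℤ) : R :=
  6 * X (Sum.inl (D - 1)) * X (Sum.inl D) - 3 * X (Sum.inl (D - 1)) * X (Sum.inl (D + 1))
    - 12 * X (Sum.inl D) ^ 2 + 9 * X (Sum.inl D) * X (Sum.inl (D + 1)) - 2 * X (Sum.inl (D + 1)) ^ 2

/-- The set of sites of a monomial. [folklore] -/
def msites (m : Var →₀ ℕ) : Finset ℤ := m.support.image Var.site

/-- The minimal site of a monomial (`0` for the constant monomial). [folklore] -/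
def minsite (m : Var →₀ ℕ) : ℤ := if h : (msites m).Nonempty then (msites m).min' h else 0

/-- The maximal site of a monomial (`0` for the constant monomial). [folklore] -/
def maxsite (m : Var →₀ ℕ) : ℤ := if h : (msites m).Nonempty then (msites m).max' h else 0

/-- The left-aligned representative of a monomial: translated so that its minimal site is `0`. [folklore] -/
def nfMon (m : Var →₀ ℕ) : Var →₀ ℕ := Finsupp.mapDomain (transl (-minsite m)) m

/-- The linear map of `𝓡` determined by its values on monic monomials (`monomial m c ↦ c • φ m`). [folklore] -/
def liftMon (φ : (Var →₀ ℕ) → R) : R →ₗ[ℝ] R :=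
  (Finsupp.lsum ℝ fun m => LinearMap.toSpanSingleton ℝ R (φ m)) ∘ₗ
    (AddMonoidAlgebra.coeffLinearEquiv ℝ).toLinearMap

/-- The left-aligned NORMAL FORM `N`: every monomial is translated to minimal site `0`.  `N` kills
`(1 - S)𝓡`, fixes constants, and `f ∈ (1 - S)𝓡 + ℝ ↔ N f ∈ ℝ`; a local conservation law
`L g ∈ (1 - S)𝓡` reads `N (L g) = 0`. [folklore] -/
def nf : R →ₗ[ℝ] R := liftMon fun m => monomial (nfMon m) 1

/-- Projection of a polynomial onto the monomials satisfying a (decidable) predicate. [folklore] -/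
def proj (P : (Var →₀ ℕ) → Prop) [DecidablePred P] : R →ₗ[ℝ] R :=
  liftMon fun m => if P m then monomial m 1 else 0

/-- The `(span s, momentum-degree e)` component of a left-aligned polynomial: the monomials with
minimal site `0`, maximal site `s` and momentum degree (`Finsupp.weight pwt`) `e`. [folklore] -/
def projSD (s : ℤ) (e : ℕ) : R →ₗ[ℝ] R :=
  proj fun m => minsite m = 0 ∧ maxsite m = s ∧ Finsupp.weight pwt m = e

/-- The Liouville operator of `pinnedChain` is the sum of its top-weight (quartic) part `lplus` and its
weight-lowering (harmonic) part `lminus` — the splitting behind the weight peeling. [folklore] -/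
theorem liouville_eq_lplus_add_lminus : ∀ ω₂ lam β : ℝ, liouville ω₂ lam β = lplus lam β + lminus ω₂ := by
  intro ω₂ lam β
  refine MvPolynomial.derivation_ext fun v => ?_
  cases v with
  | inl x => simp [liouville, lplus, lminus, mkDerivation_X]
  | inr x =>
    simp only [liouville, lplus, lminus, mkDerivation_X, Sum.elim_inr, Derivation.add_apply, force,
      forcePlus, forceMinus]
    ring

end Summit.AtomisticToContinuum.FouriersLaw.Theorems.OddChargeAlgebra

end
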